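import Summits.MatrixMultiplication.MatrixMultiplication.Theorems.SoloInformedRichTranslate

/-!
# The locking dichotomy for a pair of slices (toward the poor world of THEOREM 8.22)

This work, §8.8 (T13)(g) (gen 107). Setting of `SoloInformedCrossStar` / `SoloInformedRichTranslate`: a CU13-Def-12
realization of `⟨n,n,n⟩` in `𝒮(S⁰ × S¹, ±)`, coprime case, class map `κ : G → R` with `κ x = κ y ↔ x ∼ y`
[CohnUmans2013, arXiv:1207.6528, Def. 12].

For two indices `j₀, j` the pair structure (`SoloInformedPairStructure.Data.cross`) makes the families of class
pairs `P_i = {[a(i,j₀) + a(i,j)], [a(i,j₀) - a(i,j)]}` and `Q_k = {[b(j₀,k) + b(j,k)], [b(j₀,k) - b(j,k)]}`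
cross-intersecting, and LEMMA CI′ (`Data.locked_of_cross_rich`) locks the pair as soon as both families have `≥ 5`
members. Here we record the sharper entry condition: `P` has `≥ 5` members as soon as EITHER column `j₀` OR column
`j` of `a` takes `≥ 17` values (`card_image_sym2_ge_five_of_right`, the mirror of
`SoloInformedRichSpread.card_image_sym2_ge_five`), and likewise for `Q` and the rows `j₀`, `j` of `b`. Hence
`Data.locked_of_rich_pair`: the pair `(j₀, j)` is LOCKED (one parameter `t`: `a(i,j) ∼ a(i,j₀) ± t` for all `i`,
`b(j,k) ∼ b(j₀,k) ± t` for all `k`) whenever (a-column `j₀` or `j` is rich) and (b-row `j₀` or `j` is rich). In the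
poor world of THEOREM 8.22 (no doubly-rich index) this says: an UNLOCKED pair has both a-columns poor or both b-rows
poor. References: this work §8.8 (T13)(g); CohnUmans2013 Def. 12.
-/

namespace Summit.MatrixMultiplication.MatrixMultiplication.Theorems.TwistedTPP

namespace FibreLines

variable {ι G : Type*} [AddCommGroup G]

/-- Mirror of `card_image_sym2_ge_five`: if `x - y` takes `≥ 17` values then the class pairs `{[x_i], [y_i]}` take
`≥ 5` values. -/
theorem card_image_sym2_ge_five_of_sub [Fintype ι] [DecidableEq ι] [DecidableEq G] {R : Type*} [DecidableEq R]
    (κ : G → R) (hκ : ∀ x y, κ x = κ y ↔ SignEq x y) (x y : ι → G)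
    (h17 : 17 ≤ ((Finset.univ : Finset ι).image fun i => x i - y i).card) :
    5 ≤ ((Finset.univ : Finset ι).image fun i => s(κ (x i), κ (y i))).card := by
  have e : (fun i => s(κ (x i), κ (y i))) = fun i => s(κ (x i), κ (-y i)) := by
    funext i
    rw [(hκ (y i) (-y i)).mpr (Or.inr (neg_neg (y i)).symm)]
  rw [e]
  refine card_image_sym2_ge_five κ (fun u v => (hκ u v).mp) x (fun i => -y i) ?_
  simpa [sub_eq_add_neg] using h17

/-- **Locking of a pair from one rich column and one rich row.** If column `j₀` or column `j` of `a` takes `≥ 17`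
values, and row `j₀` or row `j` of `b` takes `≥ 17` values, then the pair `(j₀, j)` is locked with one parameter.
[this work, §8.8 (T13)(g)] -/
theorem Data.locked_of_rich_pair [Fintype ι] [DecidableEq ι] [DecidableEq G] {R : Type*} [DecidableEq R]
    (hG : ∀ x : G, x = -x → x = 0) (D : Data ι G) (κ : G → R) (hκ : ∀ x y, κ x = κ y ↔ SignEq x y) (j₀ j : ι)
    (hP : 17 ≤ ((Finset.univ : Finset ι).image fun i => D.a i j₀).card ∨
      17 ≤ ((Finset.univ : Finset ι).image fun i => D.a i j).card)
    (hQ : 17 ≤ ((Finset.univ : Finset ι).image fun k => D.b j₀ k).card ∨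
      17 ≤ ((Finset.univ : Finset ι).image fun k => D.b j k).card) :
    ∃ t : G, (∀ i, SignEq (D.a i j) (D.a i j₀ + t) ∨ SignEq (D.a i j) (D.a i j₀ - t)) ∧
      (∀ k, SignEq (D.b j k) (D.b j₀ k + t) ∨ SignEq (D.b j k) (D.b j₀ k - t)) := by
  apply D.locked_of_cross_rich κ hκ j₀ j
  · rcases hP with h | h
    · refine card_image_sym2_ge_five κ (fun x y => (hκ x y).mp) (fun i => D.a i j₀ + D.a i j)
        (fun i => D.a i j₀ - D.a i j) ?_
      have e : (fun i => D.a i j₀ + D.a i j + (D.a i j₀ - D.a i j)) =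
          (fun x : G => x + x) ∘ (fun i => D.a i j₀) := by
        funext i; simp only [Function.comp_apply]; abel
      rw [e, ← Finset.image_image, Finset.card_image_of_injective _ (add_self_injective hG)]
      exact h
    · refine card_image_sym2_ge_five_of_sub κ hκ (fun i => D.a i j₀ + D.a i j)
        (fun i => D.a i j₀ - D.a i j) ?_
      have e : (fun i => D.a i j₀ + D.a i j - (D.a i j₀ - D.a i j)) =
          (fun x : G => x + x) ∘ (fun i => D.a i j) := by
        funext i; simp only [Function.comp_apply]; abel
      rw [e, ← Finset.image_image, Finset.card_image_of_injective _ (add_self_injective hG)]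
      exact h
  · rcases hQ with h | h
    · refine card_image_sym2_ge_five κ (fun x y => (hκ x y).mp) (fun k => D.b j₀ k + D.b j k)
        (fun k => D.b j₀ k - D.b j k) ?_
      have e : (fun k => D.b j₀ k + D.b j k + (D.b j₀ k - D.b j k)) =
          (fun x : G => x + x) ∘ (fun k => D.b j₀ k) := by
        funext k; simp only [Function.comp_apply]; abel
      rw [e, ← Finset.image_image, Finset.card_image_of_injective _ (add_self_injective hG)]
      exact h
    · refine card_image_sym2_ge_five_of_sub κ hκ (fun k => D.b j₀ k + D.b j k)
        (fun k => D.b j₀ k - D.b j k) ?_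
      have e : (fun k => D.b j₀ k + D.b j k - (D.b j₀ k - D.b j k)) =
          (fun x : G => x + x) ∘ (fun k => D.b j k) := by
        funext k; simp only [Function.comp_apply]; abel
      rw [e, ← Finset.image_image, Finset.card_image_of_injective _ (add_self_injective hG)]
      exact h

/-- **Mixed locking.** If row `j₀` of `b` takes `≥ 17` values then every `j` whose a-column takes `≥ 17` values is
locked to `j₀` (one rich line on each side of the pair suffices). [this work, §8.8 (T13)(g)] -/
theorem Data.locked_of_rich_row_rich_col [Fintype ι] [DecidableEq ι] [DecidableEq G] {R : Type*} [DecidableEq R]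
    (hG : ∀ x : G, x = -x → x = 0) (D : Data ι G) (κ : G → R) (hκ : ∀ x y, κ x = κ y ↔ SignEq x y) (j₀ j : ι)
    (hb : 17 ≤ ((Finset.univ : Finset ι).image fun k => D.b j₀ k).card)
    (ha : 17 ≤ ((Finset.univ : Finset ι).image fun i => D.a i j).card) :
    ∃ t : G, (∀ i, SignEq (D.a i j) (D.a i j₀ + t) ∨ SignEq (D.a i j) (D.a i j₀ - t)) ∧
      (∀ k, SignEq (D.b j k) (D.b j₀ k + t) ∨ SignEq (D.b j k) (D.b j₀ k - t)) :=
  D.locked_of_rich_pair hG κ hκ j₀ j (Or.inr ha) (Or.inl hb)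

end FibreLines

end Summit.MatrixMultiplication.MatrixMultiplication.Theorems.TwistedTPP
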